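import Literature.MathematicalPhysics.QuantumLattice.HubbardTTPrimeGrandCanonicalPressureZeeman
import Literature.MathematicalPhysics.QuantumLattice.HubbardTTPrimeThermalPressureSpinSectorsSupportingPlane
import HarnessLib

/-!
# The `(n↑, n↓) ↔ (μ, h)` duality of the `T > 0` state functions of the 2D `t–t'` Hubbard model: every interior
# spin-density pair is realised by a chemical potential and a field

Topic `MathematicalPhysics/QuantumLattice` (family `hubbard`); the junction of
`HubbardTTPrimeGrandCanonicalPressureZeeman.lean` (`P(β; t,t',U; μ, h) = sup_{x,y} [p(x,y) + βμ(x+y) + βh(x−y)]`, the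
limit of `L⁻² log Re Z_β(H_L − μN − hM)`) and `HubbardTTPrimeThermalPressureSpinSectorsSupportingPlane.lean`
(supporting planes of the jointly concave `p = pressureTT'₂ β t t' U` at interior points). For `β > 0` and an interior
spin-density pair `(x, y) ∈ (0,1)²`:

* `exists_chemicalPotential_field_pressureTT'₂_eq` — there are `μ, h` with
  `p(x, y) = P(μ, h) − βμ(x+y) − βh(x−y)` (the supporting plane at `(x,y)` has slopes `(−β(μ+h), −β(μ−h))`);
* `pressureTT'₂_le_gcPressureTT'Zeeman_sub` — `p(x,y) ≤ P(μ,h) − βμ(x+y) − βh(x−y)` for ALL `μ, h` (every certified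
  Zeeman grand-canonical ceiling is a ceiling on the spin-resolved canonical number);
* `isGLB_pressureTT'₂`, `pressureTT'₂_eq_iInf_gcPressureTT'Zeeman` —
  `p(x, y) = inf_{(μ,h)} [P(μ, h) − βμ(x+y) − βh(x−y)]`: the spin-resolved canonical free entropy is the two-variable
  Legendre transform of the Zeeman grand-canonical pressure — the two ensembles carry the same information, and the
  model-level `(filling, magnetisation)` and `(μ, H)` axes of the `T > 0` phase map are conjugate.

Everything is PROVED; no definition, no named fact.

## Mathlib / tree search

REUSED: `exists_supporting_plane_pressureTT'₂`, `pressureTT'₂_add_le_gcPressureTT'Zeeman`, `gcPressureTT'Zeeman_le_iff`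
(tree), Mathlib `IsGLB.ciInf_eq`. `lean search 'iInf_gcPressure|chemicalPotential_field'`: only the `h = 0` analogue
`pressureTT'_eq_iInf_gcPressureTT'` (`HubbardTTPrimeGrandCanonicalEnsembleEquivalence`) (2026-08-27).

## References

* D. Ruelle, *Statistical Mechanics: Rigorous Results* (1969), §3.4. [cite: Ruelle1969, §3.4]
* R. B. Israel, *Convexity in the Theory of Lattice Gases* (1979), Thm. I.2.4. [cite: Israel1979, Thm. I.2.4]
-/

noncomputable section

namespace Literature.MathematicalPhysics.QuantumLattice

open Matrix Finset HubbardWave0 Literature.Probability.LatticeModels LiebThm1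
open _root_.Filter
open scoped _root_.Topology ComplexOrder BigOperators

namespace ThermodynamicLimit

section Duality

variable {β : ℝ} (hβ : 0 ≤ β) (t t' : ℝ) {U : ℝ} (hU : 0 ≤ U)
include hβ hU

/-- **Every Zeeman grand-canonical ceiling is a ceiling on the spin-resolved canonical number**:
`p(x, y) ≤ P(μ, h) − βμ(x+y) − βh(x−y)` for all real `μ, h` and `(x, y) ∈ [0,1)²`. [cite: Ruelle1969, §3.4] -/
theorem pressureTT'₂_le_gcPressureTT'Zeeman_sub (μ hz : ℝ) {x y : ℝ} (hx0 : 0 ≤ x) (hx1 : x < 1) (hy0 : 0 ≤ y)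
    (hy1 : y < 1) :
    pressureTT'₂ β t t' U x y ≤ gcPressureTT'Zeeman β t t' U μ hz - β * μ * (x + y) - β * hz * (x - y) := by
  have h := pressureTT'₂_add_le_gcPressureTT'Zeeman hβ t t' hU μ hz hx0 hx1 hy0 hy1
  linarith

/-- **A chemical potential and a field for every interior spin-density pair** (`β > 0`, `(x, y) ∈ (0,1)²`): there are
`μ, h` with `p(x, y) = P(μ, h) − βμ(x+y) − βh(x−y)` — the supporting plane of the concave `p` at `(x, y)` has slopes
`(−β(μ + h), −β(μ − h))`, and along it the Legendre supremum is attained at `(x, y)`.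
[cite: Ruelle1969, §3.4] [cite: Israel1979, Thm. I.2.4] -/
theorem exists_chemicalPotential_field_pressureTT'₂_eq (hβ' : 0 < β) {x y : ℝ} (hx0 : 0 < x) (hx1 : x < 1)
    (hy0 : 0 < y) (hy1 : y < 1) :
    ∃ μ hz : ℝ, pressureTT'₂ β t t' U x y = gcPressureTT'Zeeman β t t' U μ hz - β * μ * (x + y) - β * hz * (x - y) := by
  obtain ⟨s₁, s₂, hs⟩ := exists_supporting_plane_pressureTT'₂ hβ t t' hU hx0 hx1 hy0 hy1
  refine ⟨-(s₁ + s₂) / (2 * β), -(s₁ - s₂) / (2 * β), le_antisymm ?_ ?_⟩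
  · exact pressureTT'₂_le_gcPressureTT'Zeeman_sub hβ t t' hU _ _ hx0.le hx1 hy0.le hy1
  · -- the Legendre supremum lies under the supporting plane
    have e1 : β * (-(s₁ + s₂) / (2 * β)) = -(s₁ + s₂) / 2 := by field_simp
    have e2 : β * (-(s₁ - s₂) / (2 * β)) = -(s₁ - s₂) / 2 := by field_simp
    have hP : gcPressureTT'Zeeman β t t' U (-(s₁ + s₂) / (2 * β)) (-(s₁ - s₂) / (2 * β)) ≤
        pressureTT'₂ β t t' U x y + β * (-(s₁ + s₂) / (2 * β)) * (x + y) + β * (-(s₁ - s₂) / (2 * β)) * (x - y) := by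
      rw [gcPressureTT'Zeeman_le_iff hβ t t' hU]
      intro u v hu0 hu1 hv0 hv1
      have h := hs u v hu0 hu1 hv0 hv1
      rw [e1, e2]
      nlinarith [h]
    rw [e1, e2] at hP ⊢
    linarith

/-- The spin-resolved canonical number is the greatest lower bound of `{P(μ,h) − βμ(x+y) − βh(x−y)}` (`β > 0`,
`(x, y) ∈ (0,1)²`). [cite: Ruelle1969, §3.4] -/
theorem isGLB_pressureTT'₂ (hβ' : 0 < β) {x y : ℝ} (hx0 : 0 < x) (hx1 : x < 1) (hy0 : 0 < y) (hy1 : y < 1) :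
    IsGLB (Set.range fun q : ℝ × ℝ =>
      gcPressureTT'Zeeman β t t' U q.1 q.2 - β * q.1 * (x + y) - β * q.2 * (x - y)) (pressureTT'₂ β t t' U x y) := by
  refine ⟨?_, ?_⟩
  · rintro _ ⟨⟨μ, hz⟩, rfl⟩
    exact pressureTT'₂_le_gcPressureTT'Zeeman_sub hβ t t' hU μ hz hx0.le hx1 hy0.le hy1
  · intro b hb
    obtain ⟨μ, hz, hμ⟩ := exists_chemicalPotential_field_pressureTT'₂_eq hβ t t' hU hβ' hx0 hx1 hy0 hy1
    rw [hμ]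
    exact hb ⟨(μ, hz), rfl⟩

/-- **The two-variable inverse Legendre transform**: `p(β; t,t',U; x, y) = inf_{(μ,h)} [P(β; t,t',U; μ, h) − βμ(x+y) − βh(x−y)]`
(`β > 0`, `U ≥ 0`, `(x, y) ∈ (0,1)²`). [cite: Ruelle1969, §3.4] [cite: Israel1979, Thm. I.2.4] -/
theorem pressureTT'₂_eq_iInf_gcPressureTT'Zeeman (hβ' : 0 < β) {x y : ℝ} (hx0 : 0 < x) (hx1 : x < 1) (hy0 : 0 < y)
    (hy1 : y < 1) :
    pressureTT'₂ β t t' U x y =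
      ⨅ q : ℝ × ℝ, (gcPressureTT'Zeeman β t t' U q.1 q.2 - β * q.1 * (x + y) - β * q.2 * (x - y)) :=
  (isGLB_pressureTT'₂ hβ t t' hU hβ' hx0 hx1 hy0 hy1).ciInf_eq.symm

end Duality

end ThermodynamicLimit

end Literature.MathematicalPhysics.QuantumLattice
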